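import Mathlib.Probability.Distributions.Gaussian.Real
import Mathlib.MeasureTheory.Integral.Pi
import Mathlib.MeasureTheory.Constructions.Pi
import HarnessLib

/-!
# The product Gaussian `𝒩(0, v I_n)` as a density with respect to Lebesgue measure

`Literature/Probability/Distributions/`. Mathlib's `ProbabilityTheory.gaussianReal 0 v` is
`volume.withDensity (gaussianPDF 0 v)` (`v ≠ 0`), and `Measure.pi` of it is the law of `n`
i.i.d. centred Gaussians; this file identifies that product with the normalised density
`e^{-∑ᵢ xᵢ²/(2v)} dx` on `ℝ^n`:

* `lintegral_fin_nat_prod_eq_prod` — Tonelli for products over `Fin n`: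
  `∫⁻ ∏ᵢ fᵢ(xᵢ) d(⊗ μᵢ) = ∏ᵢ ∫⁻ fᵢ dμᵢ` (the `ℝ≥0∞` analogue of Mathlib's
  `MeasureTheory.integral_fin_nat_prod_eq_prod`);
* `pi_withDensity_eq_withDensity_prod` — `⊗ᵢ (dx.withDensity dᵢ) = dx^{⊗n}.withDensity (∏ᵢ dᵢ(xᵢ))`;
* `pi_gaussianReal_eq_smul_withDensity` — `𝒩(0, vI_n) = (2πv)^{-n/2} · e^{-∑xᵢ²/(2v)} dx`, and
  `pi_gaussianReal_eq_inv_smul_withDensity` — the same with the constant written as the inverse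
  total mass of the unnormalised density (so that no Gaussian integral has to be evaluated).

All [folklore].
-/

noncomputable section

open MeasureTheory ProbabilityTheory Set
open scoped ENNReal NNReal

namespace Literature.Probability.Distributions

/-- **Tonelli for finite products**: for measurable `fᵢ : Eᵢ → [0, ∞]` and σ-finite `μᵢ`,
`∫⁻ ∏ᵢ fᵢ(xᵢ) d(⊗ᵢ μᵢ) = ∏ᵢ ∫⁻ fᵢ dμᵢ`. [folklore] -/
theorem lintegral_fin_nat_prod_eq_prod {n : ℕ} {E : Fin n → Type*} {mE : ∀ i, MeasurableSpace (E i)}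
    (μ : (i : Fin n) → Measure (E i)) [∀ i, SigmaFinite (μ i)]
    (f : (i : Fin n) → E i → ℝ≥0∞) (hf : ∀ i, Measurable (f i)) :
    ∫⁻ x, ∏ i, f i (x i) ∂(Measure.pi μ) = ∏ i, ∫⁻ x, f i x ∂(μ i) := by
  induction n with
  | zero => simp
  | succ n n_ih =>
      calc ∫⁻ x, ∏ i, f i (x i) ∂(Measure.pi μ)
          = ∫⁻ x : E 0 × ((i : Fin n) → E (Fin.succ i)),
              f 0 x.1 * ∏ i : Fin n, f (Fin.succ i) (x.2 i) ∂((μ 0).prod (Measure.pi fun i => μ i.succ)) := by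
            rw [← ((measurePreserving_piFinSuccAbove μ 0).symm).lintegral_comp_emb
              (MeasurableEquiv.measurableEmbedding _)]
            simp_rw [MeasurableEquiv.piFinSuccAbove_symm_apply, Fin.insertNthEquiv,
              Fin.prod_univ_succ, Fin.insertNth_zero, Equiv.coe_fn_mk, Fin.cons_succ,
              Fin.zero_succAbove, cast_eq, Fin.cons_zero]
            rfl
        _ = (∫⁻ x, f 0 x ∂μ 0) * ∏ i : Fin n, ∫⁻ x, f (Fin.succ i) x ∂(μ i.succ) := by
            rw [← n_ih (fun i => μ i.succ) (fun i => f (Fin.succ i)) fun i => hf _, ← lintegral_prod_mul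
              (hf 0).aemeasurable]
            exact (Finset.measurable_prod _ fun i _ => (hf _).comp (measurable_pi_apply i)).aemeasurable
        _ = ∏ i, ∫⁻ x, f i x ∂(μ i) := by rw [Fin.prod_univ_succ]

/-- The indicator of a box is the product of the indicators of its sides. [folklore] -/
theorem indicator_univ_pi_prod {n : ℕ} (s : Fin n → Set ℝ) (d : Fin n → ℝ → ℝ≥0∞) :
    (Set.pi univ s).indicator (fun ω : Fin n → ℝ => ∏ i, d i (ω i)) =
      fun ω => ∏ i, (s i).indicator (d i) (ω i) := by
  funext ω
  by_cases hω : ω ∈ Set.pi univ s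
  · rw [Set.indicator_of_mem hω]
    exact Finset.prod_congr rfl fun i _ => (Set.indicator_of_mem (hω i (Set.mem_univ _)) _).symm
  · rw [Set.indicator_of_notMem hω]
    simp only [Set.mem_univ_pi, not_forall] at hω
    obtain ⟨i, hi⟩ := hω
    exact (Finset.prod_eq_zero (Finset.mem_univ i) (Set.indicator_of_notMem hi _)).symm

/-- **A finite product of measures with (real, nonnegative) densities is the product Lebesgue
measure with the product density**:
`⊗ᵢ (dx.withDensity dᵢ) = (dx^{⊗n}).withDensity (x ↦ ∏ᵢ dᵢ(xᵢ))`. [folklore] -/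
theorem pi_withDensity_eq_withDensity_prod {n : ℕ} (d : Fin n → ℝ → ℝ) (hd : ∀ i, Measurable (d i))
    (hd0 : ∀ i x, 0 ≤ d i x) :
    Measure.pi (fun i => (volume : Measure ℝ).withDensity fun x => ENNReal.ofReal (d i x)) =
      (volume : Measure (Fin n → ℝ)).withDensity fun ω => ENNReal.ofReal (∏ i, d i (ω i)) := by
  refine Measure.pi_eq (μ := fun i => (volume : Measure ℝ).withDensity fun x => ENNReal.ofReal (d i x))
    fun s hs => ?_
  have e : (fun ω : Fin n → ℝ => ENNReal.ofReal (∏ i, d i (ω i))) =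
      fun ω => ∏ i, ENNReal.ofReal (d i (ω i)) := by
    funext ω; exact ENNReal.ofReal_prod_of_nonneg fun i _ => hd0 i _
  rw [e, withDensity_apply _ (MeasurableSet.univ_pi hs), ← lintegral_indicator (MeasurableSet.univ_pi hs),
    indicator_univ_pi_prod s fun i x => ENNReal.ofReal (d i x), volume_pi,
    lintegral_fin_nat_prod_eq_prod (fun _ : Fin n => (volume : Measure ℝ))
      (fun i => (s i).indicator fun x => ENNReal.ofReal (d i x))
      fun i => (ENNReal.measurable_ofReal.comp (hd i)).indicator (hs i)]
  exact Finset.prod_congr rfl fun i _ => by rw [withDensity_apply _ (hs i), lintegral_indicator (hs i)]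

/-- **`𝒩(0, v I_n)` as a density**: for `v ≠ 0`,
`⊗ⁿ 𝒩(0, v) = (√(2πv))⁻ⁿ · (e^{-(∑ᵢ xᵢ²/2)/v} dx)`. [folklore] -/
theorem pi_gaussianReal_eq_smul_withDensity (n : ℕ) {v : ℝ≥0} (hv : v ≠ 0) :
    Measure.pi (fun _ : Fin n => gaussianReal 0 v) =
      ENNReal.ofReal ((Real.sqrt (2 * Real.pi * v))⁻¹ ^ n) •
        (volume : Measure (Fin n → ℝ)).withDensity
          fun ω => ENNReal.ofReal (Real.exp (-(∑ i, ω i ^ 2 / 2) / v)) := by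
  have e1 : (fun _ : Fin n => gaussianReal 0 v) =
      fun _ : Fin n => (volume : Measure ℝ).withDensity fun x => ENNReal.ofReal (gaussianPDFReal 0 v x) := by
    funext i; exact gaussianReal_of_var_ne_zero 0 hv
  rw [e1, pi_withDensity_eq_withDensity_prod (fun _ => gaussianPDFReal 0 v)
    (fun _ => measurable_gaussianPDFReal 0 v) fun _ x => gaussianPDFReal_nonneg 0 v x]
  have hv' : (0 : ℝ) < v := lt_of_le_of_ne v.coe_nonneg (by exact_mod_cast hv.symm)
  have e2 : (fun ω : Fin n → ℝ => ENNReal.ofReal (∏ i, gaussianPDFReal 0 v (ω i))) =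
      ENNReal.ofReal ((Real.sqrt (2 * Real.pi * v))⁻¹ ^ n) •
        fun ω => ENNReal.ofReal (Real.exp (-(∑ i, ω i ^ 2 / 2) / v)) := by
    funext ω
    simp only [Pi.smul_apply, smul_eq_mul, gaussianPDFReal]
    rw [Finset.prod_mul_distrib, Finset.prod_const, Finset.card_univ, Fintype.card_fin, ← Real.exp_sum,
      ENNReal.ofReal_mul (by positivity)]
    congr 2
    rw [neg_div, Finset.sum_div, ← Finset.sum_neg_distrib]
    refine congrArg Real.exp (Finset.sum_congr rfl fun i _ => ?_)
    rw [sub_zero]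
    field_simp
  rw [e2, withDensity_smul _ (by fun_prop)]

/-- The same identity with the constant written as the inverse total mass of the unnormalised
density `e^{-(∑xᵢ²/2)/v} dx` (both sides are probability measures). [folklore] -/
theorem pi_gaussianReal_eq_inv_smul_withDensity (n : ℕ) {v : ℝ≥0} (hv : v ≠ 0) :
    Measure.pi (fun _ : Fin n => gaussianReal 0 v) =
      ((volume : Measure (Fin n → ℝ)).withDensity
          (fun ω => ENNReal.ofReal (Real.exp (-(∑ i, ω i ^ 2 / 2) / v))) Set.univ)⁻¹ •
        (volume : Measure (Fin n → ℝ)).withDensity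
          fun ω => ENNReal.ofReal (Real.exp (-(∑ i, ω i ^ 2 / 2) / v)) := by
  have h := pi_gaussianReal_eq_smul_withDensity n hv
  have h1 : ENNReal.ofReal ((Real.sqrt (2 * Real.pi * v))⁻¹ ^ n) *
      ((volume : Measure (Fin n → ℝ)).withDensity
        (fun ω => ENNReal.ofReal (Real.exp (-(∑ i, ω i ^ 2 / 2) / v))) Set.univ) = 1 := by
    have h2 := congrArg (fun m : Measure (Fin n → ℝ) => m Set.univ) h
    simp only [measure_univ, Measure.smul_apply, smul_eq_mul] at h2
    exact h2.symm
  rw [h, ENNReal.eq_inv_of_mul_eq_one_left h1]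

end Literature.Probability.Distributions

end
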